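import Mathlib
import HarnessLib
import Summits.Ventures.LatticeQCDFlow.Exactness.NCMCGeneralSpaceOccupancyChainStart
import Summits.Ventures.LatticeQCDFlow.Exactness.NCMCGeneralSpaceWilsonHeatBathRestart

/-!
# From almost every starting configuration: the correlated-start Jarzynski estimate along the restart chain launched at a `ν₀`-typical field converges to `ΔF`

HONEST FRAMING: exact (Metropolis-corrected) sampling algorithms for lattice gauge theory;
figures of merit are autocorrelation/cost numbers at stated couplings and volumes; no
continuum-physics claim.

Venture `LatticeQCDFlow` (cell pub-lqcd), topic `Exactness`; FANOUT row 13 (`eng-snf`, GEN-17).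
NEW WORK of the cell, not a published result; no definition is introduced; nothing is cited as a
fact.  GEN-16 typed the Jarzynski / reweighting lane with correlated starts along the restart chain
of records STARTED IN ITS INVARIANT LAW `P_F` (`NCMCGeneralSpaceMarkovErgodicCriteria`,
`NCMCGeneralSpaceWilsonHeatBathRestart`: `ΔF̂_n → ΔF` a.s. whenever the level sampler `K` is
`ν₀`-invariant and minorised by a non-zero measure).  The engine starts from ONE configuration `x`
and draws its first evolution from `κF(x, ·)`.  With GEN-17's disintegration
(`NCMCGeneralSpaceOccupancyChainStart.ae_ae_trajMeasure_dirac_of_ae`,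
`trajMeasure_apply_eq_lintegral_dirac`) this file passes to `ν₀`-almost every initial
configuration.

## Content

* `ae_kernel_of_ae_fwdPathLaw` — a `P_F`-almost-sure property of records holds `κF(x, ·)`-almost
  surely for `ν₀`-a.e. `x` (`P_F = Z₀⁻¹ · ν₀ ∘ κF`).
* `ae_trajMeasure_of_ae_forall_dirac` — if a path property holds `P_{δ_ε}`-a.s. for `μ`-a.e. `ε`,
  it holds `P_μ`-a.s. (the mixture formula read backwards).
* **`CrooksPair.ae_start_tendsto_jarzynskiEstimate_restartChain`** — Crooks pair between finite
  weights (`Z₀ ≠ 0`), level sampler `K` Markov, `ν₀`-invariant, minorised by a non-zero finite `m`: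
  for `ν₀`-ALMOST EVERY initial configuration `x`, along the restart chain of records whose first
  record is drawn from `κF(x, ·)` (then `K` between launches), `ΔF̂_n → ΔF` almost surely.

NOT CLAIMED: every starting configuration; rates; error bars.
-/

namespace Summit.Ventures.LatticeQCDFlow.Exactness.GeneralNCMC

open MeasureTheory ProbabilityTheory Set Filter Finset
open scoped ENNReal Topology

variable {Ω E : Type*} [MeasurableSpace Ω] [MeasurableSpace E]

/-! ## Two disintegration lemmas -/

/-- A `P_F`-almost-sure property of records holds `κF(x, ·)`-almost surely for `ν₀`-a.e. start `x`. -/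
theorem ae_kernel_of_ae_fwdPathLaw (ν₀ : Measure Ω) [IsFiniteMeasure ν₀] (κF : Kernel Ω E)
    {p : E → Prop} (h : ∀ᵐ ε ∂(fwdPathLaw ν₀ κF), p ε) : ∀ᵐ x ∂ν₀, ∀ᵐ ε ∂(κF x), p ε := by
  rw [ae_iff] at h
  obtain ⟨N, hsub, hN, hN0⟩ := exists_measurable_superset_of_null h
  rw [fwdPathLaw, Measure.smul_apply, smul_eq_mul, mul_eq_zero] at hN0
  have hb : (ν₀.bind κF) N = 0 :=
    hN0.resolve_left (ENNReal.inv_ne_zero.2 (measure_ne_top ν₀ univ))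
  rw [Measure.bind_apply hN (Kernel.aemeasurable _),
    lintegral_eq_zero_iff (Kernel.measurable_coe _ hN)] at hb
  filter_upwards [hb] with x hx
  rw [ae_iff]
  exact measure_mono_null hsub hx

section Chain

variable {S : Type*} [MeasurableSpace S] (κ : Kernel S S) [IsMarkovKernel κ]

/-- **The mixture formula read backwards**: if a measurable-null-set-dominated path property holds
`P_{δ_ε}`-almost surely for `μ`-almost every `ε`, it holds `P_μ`-almost surely. -/
theorem ae_trajMeasure_of_ae_forall_dirac {μ : Measure S} {p : (ℕ → S) → Prop} {N : Set (ℕ → S)}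
    (hN : MeasurableSet N) (hpN : ∀ x, ¬ p x → x ∈ N)
    (h : ∀ᵐ ε ∂μ, Kernel.trajMeasure (X := fun _ : ℕ => S) (Measure.dirac ε)
      (fun n : ℕ => κ.comap (fun h : (j : ↥(Finset.Iic n)) → S => h ⟨n, Finset.mem_Iic.2 le_rfl⟩)
        (measurable_pi_apply _)) N = 0) :
    ∀ᵐ x ∂(Kernel.trajMeasure (X := fun _ : ℕ => S) μ
      (fun n : ℕ => κ.comap (fun h : (j : ↥(Finset.Iic n)) → S => h ⟨n, Finset.mem_Iic.2 le_rfl⟩)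
        (measurable_pi_apply _))), p x := by
  rw [ae_iff]
  refine measure_mono_null (fun x (hx : ¬ p x) => hpN x hx) ?_
  rw [trajMeasure_apply_eq_lintegral_dirac κ μ hN, lintegral_eq_zero_iff
    (measurable_trajMeasure_dirac κ hN)]
  exact h

end Chain

/-! ## The restart chain from `ν₀`-almost every initial configuration -/

namespace CrooksPair

variable {ν₀ ν₁ : Measure Ω} [IsFiniteMeasure ν₀] [IsFiniteMeasure ν₁] {κF κR : Kernel Ω E}
  [IsMarkovKernel κF] [IsMarkovKernel κR] {s e : E → Ω} {W : E → ℝ}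

/-- **FROM `ν₀`-ALMOST EVERY INITIAL CONFIGURATION.**  For a Crooks pair between finite weights
(`Z₀ ≠ 0`) and a `ν₀`-invariant Markov level sampler `K` minorised by a non-zero finite measure:
for `ν₀`-almost every `x`, along the restart chain of forward records whose FIRST record is drawn
from `κF(x, ·)` (and every later one from the current state after `K`), the Jarzynski estimate
`ΔF̂_n = −log((1/n) Σ e^{−W_i})` converges to `ΔF` almost surely. -/
theorem ae_start_tendsto_jarzynskiEstimate_restartChain (K : Kernel Ω Ω) [IsMarkovKernel K]
    (h0 : ν₀ univ ≠ 0) (hK : Kernel.Invariant K ν₀) (h : CrooksPair ν₀ ν₁ κF κR s e W) {ΔF : ℝ}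
    (hΔF : Real.exp (-ΔF) = ((ν₀ univ)⁻¹ * ν₁ univ).toReal) {m : Measure Ω} [IsFiniteMeasure m]
    (hm0 : m univ ≠ 0) (hmin : ∀ z, m ≤ K z) :
    ∀ᵐ x ∂ν₀, ∀ᵐ ω ∂(Kernel.trajMeasure (X := fun _ : ℕ => E) (κF x)
        (fun n : ℕ => ((κF ∘ₖ K).comap s h.measurable_s).comap
          (fun hh : (j : ↥(Finset.Iic n)) → E => hh ⟨n, Finset.mem_Iic.2 le_rfl⟩)
          (measurable_pi_apply _))),
      Tendsto (fun n : ℕ => jarzynskiEstimate (fun ε => Real.exp (-W ε)) (fun i : Fin n => ω i))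
        atTop (𝓝 ΔF) := by
  haveI := isProbabilityMeasure_fwdPathLaw ν₀ h0 κF
  -- the statement along the stationary chain, as a measurable null set of bad paths
  have hstat := h.tendsto_jarzynskiEstimate_ae_restartChain_of_measure_le K h0 hK hΔF hm0 hmin
  rw [ae_iff] at hstat
  obtain ⟨N, hsub, hN, hN0⟩ := exists_measurable_superset_of_null hstat
  -- `P_{δ_ε}(N) = 0` for `P_F`-a.e. record `ε`, hence for `κF(x)`-a.e. `ε`, `ν₀`-a.e. `x`
  have hdirac : ∀ᵐ ε ∂(fwdPathLaw ν₀ κF), Kernel.trajMeasure (X := fun _ : ℕ => E) (Measure.dirac ε)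
      (fun n : ℕ => ((κF ∘ₖ K).comap s h.measurable_s).comap
        (fun hh : (j : ↥(Finset.Iic n)) → E => hh ⟨n, Finset.mem_Iic.2 le_rfl⟩)
        (measurable_pi_apply _)) N = 0 := by
    rw [trajMeasure_apply_eq_lintegral_dirac _ _ hN,
      lintegral_eq_zero_iff (measurable_trajMeasure_dirac _ hN)] at hN0
    exact hN0
  filter_upwards [ae_kernel_of_ae_fwdPathLaw ν₀ κF hdirac] with x hx
  exact ae_trajMeasure_of_ae_forall_dirac _ hN (fun ω hω => hsub hω) hx

end CrooksPair

end Summit.Ventures.LatticeQCDFlow.Exactness.GeneralNCMC
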